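import Mathlib
import Summits.Ventures.PercRepro2.UniversalClosures

/-! # (UH*) survives the subdivision of a leaf — the abstract subdivision lemma
(seat mine-b, cell pub-perc-repro2; MINE-B.md §21.16 (paper), §22.8)

A one-hole context `C` responds to the state of its hole edge: `C[free]` has states `(x, s)` with `s : Bool`
(`false` = the hole edge red, `true` = blue) and labels `rF, bF`; `C[absent]` has states `x` and labels `rA, bA`
(the hole edge carries neither colour).  When the hole is replaced by a path of two free edges, the new network
`C[path₂]` has states `(x, s₁, s₂)`: both halves red behaves like a red edge, both blue like a blue edge, and a
mixed pair like an absent edge — so its labels are `rF (x, s)` on the diagonal `s₁ = s₂ = s` and `rA x` off it.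

**Theorem `universal_subdivision`**: `Universal rF bF → Universal rA bA → Universal` of `C[path₂]`, for ANY
labels `rF bF rA bA` (no compatibility between them is needed): a source on the diagonal takes the `C[free]`
targets (`R ↦ RR`, `B ↦ BB`), a source in the layer `RB` (resp. `BR`) takes the `C[absent]` targets in its own
layer; the four layers are pairwise disjoint and the parts' assignments are injective. -/

namespace Summit.Ventures.PercRepro2.UHClosure

open Finset

variable {X : Type*} [Preorder X] [Fintype X]

/-- the red label of `C[path₂]`: `C[free]` on the diagonal, `C[absent]` off it -/
def sdR (rF : X × Bool → ℕ) (rA : X → ℕ) : X × (Bool × Bool) → ℕ :=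
  fun p => if p.2.1 = p.2.2 then rF (p.1, p.2.1) else rA p.1
/-- the blue label of `C[path₂]` -/
def sdB (bF : X × Bool → ℕ) (bA : X → ℕ) : X × (Bool × Bool) → ℕ :=
  fun p => if p.2.1 = p.2.2 then bF (p.1, p.2.1) else bA p.1

section construction

variable (rF bF : X × Bool → ℕ) (rA bA : X → ℕ)

omit [Preorder X] [Fintype X] in
/-- a source of `C[path₂]` on the diagonal is a source of `C[free]` -/
lemma src_diag {p : X × (Bool × Bool)} (hd : p.2.1 = p.2.2) (h : USrc (sdR rF rA) (sdB bF bA) p) :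
    USrc rF bF (p.1, p.2.1) := by
  obtain ⟨h1, h2⟩ := h
  unfold sdR at h1; unfold sdB at h2
  rw [if_pos hd] at h1 h2
  exact ⟨h1, h2⟩

omit [Preorder X] [Fintype X] in
/-- a source of `C[path₂]` off the diagonal is a source of `C[absent]` -/
lemma src_off {p : X × (Bool × Bool)} (hd : ¬ p.2.1 = p.2.2) (h : USrc (sdR rF rA) (sdB bF bA) p) :
    USrc rA bA p.1 := by
  obtain ⟨h1, h2⟩ := h
  unfold sdR at h1; unfold sdB at h2
  rw [if_neg hd] at h1 h2
  exact ⟨h1, h2⟩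

/-- the `C[free]` slot of a diagonal slot -/
def slotF (q : SlotL (USrc (sdR rF rA) (sdB bF bA)) (sdB bF bA)) (hd : q.1.1.1.2.1 = q.1.1.1.2.2) :
    SlotL (USrc rF bF) bF :=
  ⟨⟨⟨(q.1.1.1.1, q.1.1.1.2.1), src_diag rF bF rA bA hd q.1.1.2.1,
      by have := q.1.1.2.2; unfold sdB at this; rw [if_pos hd] at this; exact this⟩,
    ⟨q.1.2.val, by
      have h1 := q.2; have h2 := lt_boundL bF (q.1.1.1.1, q.1.1.1.2.1)
      unfold sdB at h1; rw [if_pos hd] at h1; omega⟩⟩,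
   by have := q.2; unfold sdB at this; rw [if_pos hd] at this; exact this⟩

/-- the `C[absent]` slot of an off-diagonal slot -/
def slotA (q : SlotL (USrc (sdR rF rA) (sdB bF bA)) (sdB bF bA)) (hd : ¬ q.1.1.1.2.1 = q.1.1.1.2.2) :
    SlotL (USrc rA bA) bA :=
  ⟨⟨⟨q.1.1.1.1, src_off rF bF rA bA hd q.1.1.2.1,
      by have := q.1.1.2.2; unfold sdB at this; rw [if_neg hd] at this; exact this⟩,
    ⟨q.1.2.val, by
      have h1 := q.2; have h2 := lt_boundL bA q.1.1.1.1
      unfold sdB at h1; rw [if_neg hd] at h1; omega⟩⟩,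
   by have := q.2; unfold sdB at this; rw [if_neg hd] at this; exact this⟩

/-- the assignment of `C[path₂]` built from assignments `f` of `C[free]` and `g` of `C[absent]` -/
noncomputable def sdAssign (f : SlotL (USrc rF bF) bF → X × Bool) (g : SlotL (USrc rA bA) bA → X)
    (q : SlotL (USrc (sdR rF rA) (sdB bF bA)) (sdB bF bA)) : X × (Bool × Bool) :=
  if hd : q.1.1.1.2.1 = q.1.1.1.2.2 then
    ((f (slotF rF bF rA bA q hd)).1, ((f (slotF rF bF rA bA q hd)).2, (f (slotF rF bF rA bA q hd)).2))
  else (g (slotA rF bF rA bA q hd), q.1.1.1.2)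

omit [Preorder X] in
/-- two slots with the same source and the same index are equal -/
lemma sd_slot_ext {S : X × (Bool × Bool) → Prop} [DecidablePred S] {d : X × (Bool × Bool) → ℕ} (q q' : SlotL S d)
    (h1 : q.1.1.1 = q'.1.1.1) (h2 : q.1.2.val = q'.1.2.val) : q = q' := by
  apply Subtype.ext; apply Prod.ext
  · exact Subtype.ext h1
  · exact Fin.ext h2

end construction

/-- **(UH*) survives the subdivision of a leaf**: if `C[free]` and `C[absent]` satisfy (UH*), so does `C[path₂]`. -/
theorem universal_subdivision (rF bF : X × Bool → ℕ) (rA bA : X → ℕ)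
    (hF : Universal rF bF) (hA : Universal rA bA) : Universal (sdR rF rA) (sdB bF bA) := by
  obtain ⟨f, hf, hfs⟩ := hF
  obtain ⟨g, hg, hgs⟩ := hA
  refine ⟨sdAssign rF bF rA bA f g, ?_, ?_⟩
  · -- injectivity
    intro q q' hqq'
    unfold sdAssign at hqq'
    by_cases hd : q.1.1.1.2.1 = q.1.1.1.2.2 <;> by_cases hd' : q'.1.1.1.2.1 = q'.1.1.1.2.2
    · rw [dif_pos hd, dif_pos hd'] at hqq'
      have e1 : (f (slotF rF bF rA bA q hd)).1 = (f (slotF rF bF rA bA q' hd')).1 := (Prod.mk.inj hqq').1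
      have e2 : (f (slotF rF bF rA bA q hd)).2 = (f (slotF rF bF rA bA q' hd')).2 :=
        (Prod.mk.inj (Prod.mk.inj hqq').2).1
      have e : f (slotF rF bF rA bA q hd) = f (slotF rF bF rA bA q' hd') := Prod.ext e1 e2
      have h3 := hf e
      have hx : q.1.1.1.1 = q'.1.1.1.1 := congrArg (fun s : SlotL (USrc rF bF) bF => s.1.1.1.1) h3
      have hs : q.1.1.1.2.1 = q'.1.1.1.2.1 := congrArg (fun s : SlotL (USrc rF bF) bF => s.1.1.1.2) h3
      have hidx : q.1.2.val = q'.1.2.val := congrArg (fun s : SlotL (USrc rF bF) bF => s.1.2.val) h3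
      apply sd_slot_ext q q' _ hidx
      apply Prod.ext hx
      apply Prod.ext hs
      rw [← hd, ← hd']; exact hs
    · rw [dif_pos hd, dif_neg hd'] at hqq'
      exfalso
      have e2 := (Prod.mk.inj hqq').2
      have h21 : (f (slotF rF bF rA bA q hd)).2 = q'.1.1.1.2.1 := (Prod.mk.inj e2).1
      have h22 : (f (slotF rF bF rA bA q hd)).2 = q'.1.1.1.2.2 := (Prod.mk.inj e2).2
      exact hd' (h21.symm.trans h22)
    · rw [dif_neg hd, dif_pos hd'] at hqq'
      exfalso
      have e2 := (Prod.mk.inj hqq').2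
      have h21 : q.1.1.1.2.1 = (f (slotF rF bF rA bA q' hd')).2 := (Prod.mk.inj e2).1
      have h22 : q.1.1.1.2.2 = (f (slotF rF bF rA bA q' hd')).2 := (Prod.mk.inj e2).2
      exact hd (h21.trans h22.symm)
    · rw [dif_neg hd, dif_neg hd'] at hqq'
      have e1 : g (slotA rF bF rA bA q hd) = g (slotA rF bF rA bA q' hd') := (Prod.mk.inj hqq').1
      have e2 : q.1.1.1.2 = q'.1.1.1.2 := (Prod.mk.inj hqq').2
      have h3 := hg e1
      have hx : q.1.1.1.1 = q'.1.1.1.1 := congrArg (fun s : SlotL (USrc rA bA) bA => s.1.1.1) h3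
      have hidx : q.1.2.val = q'.1.2.val := congrArg (fun s : SlotL (USrc rA bA) bA => s.1.2.val) h3
      exact sd_slot_ext q q' (Prod.ext hx e2) hidx
  · -- the targets
    intro q
    unfold sdAssign
    by_cases hd : q.1.1.1.2.1 = q.1.1.1.2.2
    · rw [dif_pos hd]
      obtain ⟨hle, hr, hb⟩ := hfs (slotF rF bF rA bA q hd)
      have hsrc : (slotF rF bF rA bA q hd).1.1.1 = (q.1.1.1.1, q.1.1.1.2.1) := rfl
      rw [hsrc] at hle hb
      have hle1 : (f (slotF rF bF rA bA q hd)).1 ≤ q.1.1.1.1 := (Prod.mk_le_mk.1 hle).1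
      have hle2 : (f (slotF rF bF rA bA q hd)).2 ≤ q.1.1.1.2.1 := (Prod.mk_le_mk.1 hle).2
      refine ⟨Prod.mk_le_mk.2 ⟨hle1, Prod.mk_le_mk.2 ⟨hle2, hd ▸ hle2⟩⟩, ?_, ?_⟩
      · show sdR rF rA _ = 1
        unfold sdR; rw [if_pos rfl]; exact hr
      · show sdB bF bA _ ≤ sdB bF bA _ + 1
        unfold sdB; rw [if_pos hd, if_pos rfl]; simpa using hb
    · rw [dif_neg hd]
      obtain ⟨hle, hr, hb⟩ := hgs (slotA rF bF rA bA q hd)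
      have hsrc : (slotA rF bF rA bA q hd).1.1.1 = q.1.1.1.1 := rfl
      rw [hsrc] at hle hb
      refine ⟨Prod.mk_le_mk.2 ⟨hle, le_rfl⟩, ?_, ?_⟩
      · show sdR rF rA _ = 1
        unfold sdR; rw [if_neg hd]; exact hr
      · show sdB bF bA _ ≤ sdB bF bA _ + 1
        unfold sdB; rw [if_neg hd, if_neg hd]; exact hb

end Summit.Ventures.PercRepro2.UHClosure
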